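import Literature.NumberTheory.GaussSums.KummerSector
import Literature.Computability.Cryptography.ClassBQP
import Literature.Computability.Complexity.BoolEncodings

/-!
# Birth skeleton (BC3) for the split child `KummerSectorBQP` (X₁) of `ArgLeg` (stmt-QuantumAdvantage-14637)

`KummerSectorBQP`: Kummer's sector LANGUAGE `KummerSector = {⟨p, r, k⟩ : p ≡ 1 (3) prime, r a primitive root mod p,
k = the sector of g(χ_{p,r})}` is in `BQP`.  Line: (STUB 1, quantum) the sector itself — two bits — is an
`IsQSolvable` search problem on the promise (van Dam–Seroussi phase estimation of `arg g(χ_{p,r})` to `±π/4`, the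
three candidate angles `arg π/3 + 2πk/3` being classical from the primary `π ∣ r^{(p-1)/3} − ω`, sibling
`GaussCubePrimary`); (STUB 2, quantum) primitive-root TESTING is in `BQP` (factor `p − 1` by Shor, check
`r^{(p-1)/ℓ} ≠ 1`); (STUB 3, closure) a language decided by polynomial-time classical control around one call of
each subroutine, with amplification, is in `BQP` (Bennett–Bernstein–Brassard–Vazirani 1997 §4; the tree's
`IsQSolvable`/`BQP` circuit-family model, cf. `mem_BQP_of_isQSolvable_bit`, `isQSolvable_of_mem_FPRel_BQP_holds`).
-/

set_option linter.dupNamespace false -- `QuantumAdvantage.QuantumAdvantage` is the D-0017 nested layout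

namespace Summit.QuantumAdvantage.QuantumAdvantage.Cruxes.ArgLeg.KummerSectorBQPBirth

open _root_.Computability
open Literature.Computability.Complexity (boolPair)
open Literature.Computability.Cryptography (IsQSolvable BQP)
open Literature.NumberTheory.GaussSums

/-- The split child, verbatim (defeq to the route decl once installed). -/
def KummerSectorBQP : Prop :=
  Literature.NumberTheory.GaussSums.KummerSector ∈ Literature.Computability.Cryptography.BQP

/-- The Kummer sector as a SEARCH problem on the promise: input `⟨bin p, bin r⟩`, output the two bits of
`kummerSectorIndex p r` (fixed width, little-endian) on the first two wires. -/
def SectorSearch : Prop :=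
  IsQSolvable fun x => {y | ∀ p r : ℕ, p.Prime → x = boolPair (encodeNat p) (encodeNat r) → p % 3 = 1 →
    IsPrimitiveRoot (r : ZMod p) (p - 1) →
      List.ofFn (fun i : Fin 2 => (kummerSectorIndex p r : ℕ).testBit i.val) <+: y}

/-- Primitive-root testing as a language: `{⟨bin p, bin r⟩ : p prime, r a primitive root mod p}`. -/
def PrimRootLang : Language Bool :=
  {w | ∃ p r : ℕ, w = boolPair (encodeNat p) (encodeNat r) ∧ p.Prime ∧ IsPrimitiveRoot (r : ZMod p) (p - 1)}

/-- STUB 1 (van Dam–Seroussi 2002 Thm 1 + classical candidates): the sector search problem is `IsQSolvable` —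
estimate `arg g(χ_{p,r})` to `±π/4` with probability `≥ 11/12` (eigenphase of `|χ⟩` under the `χ`-twisted Fourier
transform; `|χ⟩` by Shor's discrete logarithm), compute the primary `π = a + bω ∣ r^{(p-1)/3} − ω` by Euclid in
`ℤ[ω]` (classical), and output the `k` whose candidate `arg π/3 + 2πk/3` is nearest (the candidates are `2π/3`
apart, so `±π/4` decides). [VanDamSeroussi2002, §4 Thm 1; IrelandRosen1990, Ch. 9 §12] -/
theorem stub_sector_search : SectorSearch := by
  sorry

/-- STUB 2 (Shor): primitive-root testing is in `BQP` — factor `p − 1` (Shor 1997 §5, in the tree's model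
`factoring_mem_FBQP`-style), then `r` is a primitive root iff `r^{(p-1)/ℓ} ≢ 1 (mod p)` for every prime `ℓ ∣ p − 1`;
primality of `p` by AKS. [Shor1997, §5] -/
theorem stub_primroot_BQP : PrimRootLang ∈ BQP := by
  sorry

/-- STUB 3 (closure under classical polynomial-time control, BBBV 1997 §4): parse `w = ⟨bin p, ⟨bin r, bin k⟩⟩`
(`boolUnpair`; reject malformed input, `k ≥ 3`, `p % 3 ≠ 1`), run the primitive-root decider (amplified to error
`≤ 1/12`) and the sector search (amplified by majority over the 2-bit outputs, exact on the promise), accept iff the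
former accepts and the latter returns `k`; one uniform Clifford+T family, total error `≤ 1/3`.
[BennettBernsteinBrassardVazirani1997, §4; BernsteinVazirani1997, §8] -/
theorem stub_decide (h1 : SectorSearch) (h2 : PrimRootLang ∈ BQP) : KummerSectorBQP := by
  sorry

/-- COMPOSITION (kernel-checked, no sorry): the three stubs give `KummerSectorBQP`. -/
theorem KummerSectorBQP_of (h1 : SectorSearch) (h2 : PrimRootLang ∈ BQP)
    (h3 : SectorSearch → PrimRootLang ∈ BQP → KummerSectorBQP) : KummerSectorBQP :=
  h3 h1 h2

end Summit.QuantumAdvantage.QuantumAdvantage.Cruxes.ArgLeg.KummerSectorBQPBirth
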